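/-
Copyright (c) 2026 the pub-hodgecm-mathlib formalisation cell (harness21).  Prover seat hodgecm-mathlib-A-p12 (g24), 2026-09-02.  «S3-ram» seeding wave (LEAD F0P3a-plan (g12)
T11-80∕T11-84; owner F0P3a-p06 (g15)): organ (B-i) «DEPTH-REFINED FIXED BALLS» of the (α₂) TYPE-(2) line, III — the COUNTS at ODD discriminant depth (edge balls) in the coset currency of ★ FILE C (p847245).  Kernel lane,
`--supports stmt-HodgeConjecture-24833`.
-/
import Literature.NumberTheory.Rogawski1990.DepthZeroKappaTransferTypeTwoRamifiedRescaling   -- ★ (this seat) I: §1 `2 × 2` algebra, §2 the rescaled element `γ^{(j)}`; ⊇ ★ FILE C∕B∕A, ★ p847070, ★ p847118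
import Literature.NumberTheory.Rogawski1990.LocalEndoscopicChartDatumCM                       -- ★ `isRegularElt_iff_charpoly_localNonsplitEquiv`
import HarnessLib

/-!
# Depth-refined fixed balls of a type-(2) element at a tame-ramified place, III — THE COUNTS AT ODD DEPTH `N = 2n+1`: `#{hK⁰ : (γ_W − ½tr)·(h𝒪_w²) ⊆ ϖ_v^j·(h𝒪_w²)} + 1
# = #{hC′ : …} = 2·Σ_(k≤n−j) q^k = m♯(N − 2j)`, `j ≤ n` — edge balls (Labesse–Langlands 1979 §2 Lemma 2.1; Kottwitz 1988 §2; Rogawski 1990 §4.9)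

Topic `NumberTheory/Rogawski1990`; namespace `Literature.NumberTheory.Automorphic.UnitaryGroup`.  THEOREMS ONLY (no definition, no instance, no notation, no named fact,
no `sorry`); kernel lane `--supports stmt-HodgeConjecture-24833`.  Cell `pub/hodgecm-mathlib` (D-0151), crux H413; «S3-ram» seeding wave (count-neutral); seat A-p12 (g24),
heir-architect of the (α₂) line; organ (B-i) of the (d-v-dict) lane = the inner balls `m⁰(N−2)`, `m⁰(N−4)` of F0P3a-p07 (g13)'s ledger v1.3 law (S-0)∕(L2) feeding
`stub_T2G_zero`∕`stub_T2G_pm` (the dischargers of the ∃V sockets ★ p847450∕★ p847470∕p847471).  HONEST LABEL: HC_CM is proved only modulo the cell's 2 remaining named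
inputs (hLiu418 24832, h413 24833) until rung 0 closes; nothing printed is asserted here — an assembly of ★ counts through the rescaling of file I.

THIS FILE = the ODD-DEPTH twin of file II (`…DepthBalls.lean`, `natCard_depthFixed_selfDual_and_modular_of_even_depth_ramified`); the statement below is file II's with
`exp(−2·2n) ↦ exp(−2(2n+1))`, `j < n ↦ j ≤ n`, vertex balls ↦ EDGE balls.  THE STATEMENT of file II, recalled (`…_of_even_depth_ramified`).  `v` tame-ramified non-split in the CM field `L` (`e(w|v) ≠ 1`, `2 ∈ 𝒪_w^×`), `ϖ` the
anti-fixed uniformiser of `L_w`, `U₂ = U(Φ₂)(L⁺_v)`, `E₂` the one-place model (★ `localNonsplitEquiv`), `K⁰ = U(Φ₂)(𝒪_v)` (↔ `GL₂(𝒪_w)`, the stabiliser of the self-dual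
`𝒪_w²` — an EDGE of the tree of `SL₂(L⁺_v)`), `C′ ↔ D_ϖ GL₂(𝒪_w) D_ϖ⁻¹` (a VERTEX), `q = #(𝓞_{L⁺}∕v)`.  For `γ₂ ∈ U₂` of TYPE (2) (no root of `χ_{γ₂,w}` in `L_w`) with
`|tr² − 4det|_w(γ_{2,w}) = exp(−2·2n)` and `j < n`, with `c := ½ tr γ_{2,w}`:
  `#{hK⁰ : |(E₂(h⁻¹γ₂h) − c·1)_{ab}|_w ≤ |ϖ|^{2j} ∀ a b} = (q+1)·Σ_(k<n−j) q^k`,   `#{hC′ : |ϖ^b ϖ^{−a}(E₂(h⁻¹γ₂h) − c·1)_{ab}|_w ≤ |ϖ|^{2j} ∀ a b} = 1 + (q+1)·Σ_(k<n−j) q^k`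
(such cosets are automatically `γ₂`-fixed).  READING: `hK⁰ ↦ B = E₂(h)·𝒪_w²` is the self-dual lattice, `E₂(h⁻¹γ₂h) − c·1` is the matrix of `γ_W − c` on `B`, so the condition
is `(γ_W − c)·B ⊆ ϖ^{2j}B = ϖ_v^j B`: THE NUMBER OF `γ_W`-FIXED SELF-DUAL LATTICES ON WHICH `γ_W − ½tr γ_W` IS `ϖ_v^j`-DIVISIBLE IS `m⁰(2(n−j))`, the edge count of the
vertex ball of radius `n − j` (and the vertex count `m♯(2(n−j))` for the modular column).  On the 2-deep tube `|c − 1|_w ≥ |ϖ|²`, so for `j = 1` the condition is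
`(γ_W − 1)B ⊆ ϖ²B` = «label `0` on the axis» of the ledger: `#` = `m⁰(N−2)` = law (L2); the depths of `γ_W − c` on fixed `B` are odd (`2(n−m′)+1`, `m′` the far-endpoint
distance), which is why `⊆ ϖ^{2j}` and `⊆ ϖ^{2j+1}` cut out the same set.
THE PROOF.  File I §2 produces the RESCALED `γ₂^{(j)} = E₂⁻¹(u′)`, `u′ = λ_j⁻¹(1 + (2ϖ_v^{−j}∕t)s⁻¹(γ_{2,w} − c))`, again of type (2) with unramified-elliptic datum at depth
`2·2(n−j)`; its monodromy at `h` is the affine image `s′·1 + k·(E₂(h⁻¹γ₂h) − c·1)` of the monodromy of `γ₂` (`|s′| = 1`, `|k|⁻¹ = |ϖ|^{2j}`, file I `conj_affine`), so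
`h⁻¹γ₂^{(j)}h ∈ K⁰ ⟺` the `K⁰`-condition and `∈ C′ ⟺` the `C′`-condition (file I `forall_v_le_one_affine_iff`; `|det| = 1` is automatic, ★ `v_det_coe_eq_one_of_mem_placeForm`;
★ `forall_v_sharp_iff_coe_mem_map_conj` for the twist): the two sets ARE `Fix(U₂⧸K⁰)` and `Fix(U₂⧸C′)` of `γ₂^{(j)}`, counted by ★ FILE B `sub_one_mul_natCard_fixedBy_add_two_eq_
of_unramified_elliptic` (= ★ p847070) and ★ FILE A `natCard_fixedBy_add_one_eq_natCard_fixedBy_of_deep_of_ramified` (regularity: file I `charpoly_separable_of_disc_ne_zero` +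
★ `isRegularElt_iff_charpoly_localNonsplitEquiv`; no root: file I `isRoot_charpoly_of_affine`; compact centraliser: ★ `compactSpace_centralizer_cmDatum_two_of_not_exists_isRoot`;
deep trace `|2s′ − 2| < 1`), with ★ FILE C's arithmetic.  NOT HERE (sequel): the odd depth `N = 2n+1` (same rescaling with `π₁` for `ε₀`, edge balls), and the class
distribution on the shells (organ (B-ii)).

* §3′ **`natCard_depthFixed_selfDual_and_modular_of_odd_depth_ramified`** — `|tr² − 4det|_w = exp(−2(2n+1))`, `j ≤ n`: `#(K⁰-column) + 1 = 2·Σ_(k<n−j+1) q^k = #(C′-column)`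
  (ramified-elliptic datum `π₁`, ★ p847118 odd branch, ★ FILE B `…_of_ramified_elliptic`, ★ FILE A); keyed on `(hirr, hN, j ≤ n)` only.

## References
* [LabesseLanglands1979] J.-P. Labesse, R. P. Langlands, *L-indistinguishability for SL(2)*, Canad. J. Math. 31 (1979): §2 Lemma 2.1 p. 8 (fixed balls of elliptic tori).
* [Kottwitz1988] R. E. Kottwitz, *Tamagawa numbers*, Ann. of Math. 127 (1988): §2 (fixed points on the building; orbit–stabiliser).
* [Rogawski1990] J. D. Rogawski, *Automorphic Representations of Unitary Groups in Three Variables*, Ann. of Math. Stud. 123 (1990): §4.9 Lemma 4.9.3 p. 56, Prop. 4.9.1 p. 55.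
* [Serre1980Trees] J.-P. Serre, *Trees* (1980): Ch. II §1.1 (balls in the `(q+1)`-regular tree).
-/

set_option autoImplicit false

noncomputable section

open MeasureTheory Measure Set NumberField IsDedekindDomain Matrix ValuativeRel MulAction Finset Polynomial
open scoped ValuativeRel Matrix MatrixGroups WithZero

namespace Literature.NumberTheory.Automorphic.UnitaryGroup

open Literature.NumberTheory.Rogawski1990 Literature.NumberTheory.Automorphic Literature.NumberTheory.Automorphic.IntegralReduction
open Literature.NumberTheory.Automorphic.HermitianLatticeTree Literature.GroupTheory Literature.NumberTheory.GaloisRepresentations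

/-! ## §3′ The depth-refined fixed-coset counts of a type-(2) `γ₂` at ODD discriminant depth `2n+1` (edge balls; the `cmDatum` currency of ★ FILE C) -/

section CountsOdd

variable (L : Type) [Field L] [NumberField L] [IsCMField L] (v : HeightOneSpectrum (𝓞 ↥(maximalRealSubfield L)))
  (w : PlacesOver L v) (hw : IsCMField.complexConj L • w.1 = w.1)

set_option maxHeartbeats 1600000 in
include hw in
/-- **DEPTH-REFINED FIXED BALLS AT ODD DEPTH `2n+1` (edge ball of radius `n − j`).**  Same setting with `|tr² − 4det|_w(γ_{2,w}) = exp(−2(2n+1))` (ramified-elliptic descent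
`tr²g − 4det g = π₁z²`, `|π₁| = |ϖ_F|`, ★ p847118) and `j ≤ n`: the depth-refined `C′`-cosets number **`2·Σ_(k≤n−j) q^k = m♯(2(n−j)+1)`** and the `K⁰`-cosets **`2·Σ_(k≤n−j) q^k − 1 =
m⁰(2(n−j)+1)`** (stated additively).  The rescaled element has the ramified-elliptic datum `(2, det g′, 2zϖ_F^(−j)∕t, π₁, n−j)`; counts by ★ FILE B
`sub_one_mul_natCard_fixedBy_add_two_eq_of_ramified_elliptic` and ★ FILE A. [cite: LabesseLanglands1979, §2 Lemma 2.1 p. 8] [cite: Kottwitz1988, §2] [cite: Rogawski1990, §4.9 Lemma 4.9.3 p. 56] -/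
theorem natCard_depthFixed_selfDual_and_modular_of_odd_depth_ramified (he : v.asIdeal.ramificationIdx' w.1.asIdeal ≠ 1) (h2 : IsUnit (2 : 𝒪[(w.1.adicCompletion L)]))
    (ϖ : (w.1.adicCompletion L)ˣ) (hϖ : Valued.v (ϖ : (w.1.adicCompletion L)) = WithZero.exp (-1 : ℤ))
    (hσϖ : galAdicCompletionMap (L := L) (IsCMField.complexConj L) hw (ϖ : (w.1.adicCompletion L)) = -(ϖ : (w.1.adicCompletion L)))
    (C' : Subgroup ((cmDatum L 2 (Matrix.of fun i j : Fin 2 => if i.val + j.val + 1 = 2 then (1 : L) else 0)).Local v))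
    (hC' : ∀ g, g ∈ C' ↔ (((localNonsplitEquiv (IsCMField.complexConj L) (Matrix.of fun i j : Fin 2 => if i.val + j.val + 1 = 2 then (1 : L) else 0) (IsCMField.complexConj_ne_one L) w hw) g : ↥(unitaryGroupOfForm (galAdicCompletionMap (L := L) (IsCMField.complexConj L) hw) (placeForm (Matrix.of fun i j : Fin 2 => if i.val + j.val + 1 = 2 then (1 : L) else 0) w.1))) : GL (Fin 2) (w.1.adicCompletion L)) ∈ (glInt 2 (w.1.adicCompletion L)).map (MulAut.conj (glDiagonal 2 (w.1.adicCompletion L) ![1, ϖ])).toMonoidHom)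
    (hC'o : IsOpen (C' : Set ((cmDatum L 2 (Matrix.of fun i j : Fin 2 => if i.val + j.val + 1 = 2 then (1 : L) else 0)).Local v))) (hC'c : IsCompact (C' : Set ((cmDatum L 2 (Matrix.of fun i j : Fin 2 => if i.val + j.val + 1 = 2 then (1 : L) else 0)).Local v)))
    (γ₂ : ((cmDatum L 2 (Matrix.of fun i j : Fin 2 => if i.val + j.val + 1 = 2 then (1 : L) else 0)).Local v))
    (hirr : ¬ ∃ x : (w.1.adicCompletion L), (((((localNonsplitEquiv (IsCMField.complexConj L) (Matrix.of fun i j : Fin 2 => if i.val + j.val + 1 = 2 then (1 : L) else 0) (IsCMField.complexConj_ne_one L) w hw) γ₂ : ↥(unitaryGroupOfForm (galAdicCompletionMap (L := L) (IsCMField.complexConj L) hw) (placeForm (Matrix.of fun i j : Fin 2 => if i.val + j.val + 1 = 2 then (1 : L) else 0) w.1))) : GL (Fin 2) (w.1.adicCompletion L)) : Matrix (Fin 2) (Fin 2) (w.1.adicCompletion L)).charpoly).IsRoot x)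
    {n : ℕ} (hN : Valued.v (((((localNonsplitEquiv (IsCMField.complexConj L) (Matrix.of fun i j : Fin 2 => if i.val + j.val + 1 = 2 then (1 : L) else 0) (IsCMField.complexConj_ne_one L) w hw) γ₂ : ↥(unitaryGroupOfForm (galAdicCompletionMap (L := L) (IsCMField.complexConj L) hw) (placeForm (Matrix.of fun i j : Fin 2 => if i.val + j.val + 1 = 2 then (1 : L) else 0) w.1))) : GL (Fin 2) (w.1.adicCompletion L)) : Matrix (Fin 2) (Fin 2) (w.1.adicCompletion L)).trace ^ 2 - 4 * ((((localNonsplitEquiv (IsCMField.complexConj L) (Matrix.of fun i j : Fin 2 => if i.val + j.val + 1 = 2 then (1 : L) else 0) (IsCMField.complexConj_ne_one L) w hw) γ₂ : ↥(unitaryGroupOfForm (galAdicCompletionMap (L := L) (IsCMField.complexConj L) hw) (placeForm (Matrix.of fun i j : Fin 2 => if i.val + j.val + 1 = 2 then (1 : L) else 0) w.1))) : GL (Fin 2) (w.1.adicCompletion L)) : Matrix (Fin 2) (Fin 2) (w.1.adicCompletion L)).det) = WithZero.exp (-((2 * (2 * n + 1) : ℕ) : ℤ)))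
    {j : ℕ} (hjn : j ≤ n) :
    Nat.card {x : ((cmDatum L 2 (Matrix.of fun i j : Fin 2 => if i.val + j.val + 1 = 2 then (1 : L) else 0)).Local v) ⧸ (cmLocalIntegralLevel L 2 (Matrix.of fun i j : Fin 2 => if i.val + j.val + 1 = 2 then (1 : L) else 0) v) | ∃ h : ((cmDatum L 2 (Matrix.of fun i j : Fin 2 => if i.val + j.val + 1 = 2 then (1 : L) else 0)).Local v), x = (h : ((cmDatum L 2 (Matrix.of fun i j : Fin 2 => if i.val + j.val + 1 = 2 then (1 : L) else 0)).Local v) ⧸ (cmLocalIntegralLevel L 2 (Matrix.of fun i j : Fin 2 => if i.val + j.val + 1 = 2 then (1 : L) else 0) v)) ∧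
      ∀ a b : Fin 2, Valued.v ((((((localNonsplitEquiv (IsCMField.complexConj L) (Matrix.of fun i j : Fin 2 => if i.val + j.val + 1 = 2 then (1 : L) else 0) (IsCMField.complexConj_ne_one L) w hw) (h⁻¹ * γ₂ * h) : ↥(unitaryGroupOfForm (galAdicCompletionMap (L := L) (IsCMField.complexConj L) hw) (placeForm (Matrix.of fun i j : Fin 2 => if i.val + j.val + 1 = 2 then (1 : L) else 0) w.1))) : GL (Fin 2) (w.1.adicCompletion L)) : Matrix (Fin 2) (Fin 2) (w.1.adicCompletion L)) - (((((localNonsplitEquiv (IsCMField.complexConj L) (Matrix.of fun i j : Fin 2 => if i.val + j.val + 1 = 2 then (1 : L) else 0) (IsCMField.complexConj_ne_one L) w hw) γ₂ : ↥(unitaryGroupOfForm (galAdicCompletionMap (L := L) (IsCMField.complexConj L) hw) (placeForm (Matrix.of fun i j : Fin 2 => if i.val + j.val + 1 = 2 then (1 : L) else 0) w.1))) : GL (Fin 2) (w.1.adicCompletion L)) : Matrix (Fin 2) (Fin 2) (w.1.adicCompletion L)).trace / 2) • (1 : Matrix (Fin 2) (Fin 2) (w.1.adicCompletion L))) a b)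 ≤ Valued.v ((ϖ : (w.1.adicCompletion L)) ^ (2 * j))} + 1 =
      2 * ∑ k ∈ Finset.range (n - j + 1), Nat.card (𝓞 ↥(maximalRealSubfield L) ⧸ v.asIdeal) ^ k ∧
    Nat.card {x : ((cmDatum L 2 (Matrix.of fun i j : Fin 2 => if i.val + j.val + 1 = 2 then (1 : L) else 0)).Local v) ⧸ C' | ∃ h : ((cmDatum L 2 (Matrix.of fun i j : Fin 2 => if i.val + j.val + 1 = 2 then (1 : L) else 0)).Local v), x = (h : ((cmDatum L 2 (Matrix.of fun i j : Fin 2 => if i.val + j.val + 1 = 2 then (1 : L) else 0)).Local v) ⧸ C') ∧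
      ∀ a b : Fin 2, Valued.v ((ϖ : (w.1.adicCompletion L)) ^ (b : ℕ) * ((ϖ : (w.1.adicCompletion L)) ^ (a : ℕ))⁻¹ * (((((localNonsplitEquiv (IsCMField.complexConj L) (Matrix.of fun i j : Fin 2 => if i.val + j.val + 1 = 2 then (1 : L) else 0) (IsCMField.complexConj_ne_one L) w hw) (h⁻¹ * γ₂ * h) : ↥(unitaryGroupOfForm (galAdicCompletionMap (L := L) (IsCMField.complexConj L) hw) (placeForm (Matrix.of fun i j : Fin 2 => if i.val + j.val + 1 = 2 then (1 : L) else 0) w.1))) : GL (Fin 2) (w.1.adicCompletion L)) : Matrix (Fin 2) (Fin 2) (w.1.adicCompletion L)) - (((((localNonsplitEquiv (IsCMField.complexConj L) (Matrix.of fun i j : Fin 2 => if i.val + j.val + 1 = 2 then (1 : L) else 0) (IsCMField.complexConj_ne_one L) w hw) γ₂ : ↥(unitaryGroupOfForm (galAdicCompletionMap (L := L) (IsCMField.complexConj L) hw) (placeForm (Matrix.of fun i j : Fin 2 => if i.val + j.val + 1 = 2 then (1 : L) else 0) w.1))) : GL (Fin 2) (w.1.adicCompletion L)) : Matrix (Fin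 2) (Fin 2) (w.1.adicCompletion L)).trace / 2) • (1 : Matrix (Fin 2) (Fin 2) (w.1.adicCompletion L))) a b) ≤ Valued.v ((ϖ : (w.1.adicCompletion L)) ^ (2 * j))} =
      2 * ∑ k ∈ Finset.range (n - j + 1), Nat.card (𝓞 ↥(maximalRealSubfield L) ⧸ v.asIdeal) ^ k := by
  have hϖ0 : (ϖ : (w.1.adicCompletion L)) ≠ 0 := ϖ.ne_zero
  obtain ⟨h2v, h2v0⟩ := valued_two_eq_one_of_isUnit_two_of_ramified L v w hw he h2
  -- the one-place element, its (W1) descent, the non-square unit, the uniformiser downstairs, the parity (★ p847118, ODD branch)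
  have hu := coe_mem_unitaryGroupOfForm_antidiag_two_of_mem_placeForm L w hw ((localNonsplitEquiv (IsCMField.complexConj L) (Matrix.of fun i j : Fin 2 => if i.val + j.val + 1 = 2 then (1 : L) else 0) (IsCMField.complexConj_ne_one L) w hw) γ₂)
  obtain ⟨s, g, hs, hsg⟩ := descent_of_mem_unitaryGroupOfForm_antidiag L v w hw hσϖ hϖ0 _ hu
  obtain ⟨ε₀, -, hns⟩ := exists_forall_valuation_sq_sub_eq_one L v h2v
  have hns' : ∀ b : (v.adicCompletion ↥(maximalRealSubfield L)), Valued.v b ≤ 1 → Valued.v (b ^ 2 - ε₀) = 1 := fun b hb =>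
    (v_eq_one_iff_valuation_eq_one _).2 (hns b ((v_le_one_iff_mem_integer b).1 hb))
  have hϖF := HeckeCharacter.valued_uniformizer (K := ↥(maximalRealSubfield L)) v
  obtain ⟨ht, hpar⟩ := descent_trace_ne_zero_and_parity_of_mem_unitaryGroupOfForm_of_ramified L v w hw he h2v hu hirr (by omega) hN hϖ0
    (g := (g : Matrix (Fin 2) (Fin 2) (v.adicCompletion ↥(maximalRealSubfield L)))) hsg hns' hϖF
  obtain ⟨n', hn', -⟩ | ⟨n', hn', π₁, z, hπ₁, hz, hD, hzn⟩ := hpar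
  · exfalso; omega
  have hnn : n' = n := by omega
  rw [hnn] at hzn
  have hπ₁' : valuation (v.adicCompletion ↥(maximalRealSubfield L)) π₁ = valuation (v.adicCompletion ↥(maximalRealSubfield L)) (HeckeCharacter.uniformizer ↥(maximalRealSubfield L) v : v.adicCompletion ↥(maximalRealSubfield L)) := (v_eq_iff_valuation_eq _ _).1 hπ₁
  have hzn' : valuation (v.adicCompletion ↥(maximalRealSubfield L)) (z * ((g : Matrix (Fin 2) (Fin 2) (v.adicCompletion ↥(maximalRealSubfield L))).trace)⁻¹) = valuation (v.adicCompletion ↥(maximalRealSubfield L)) (HeckeCharacter.uniformizer ↥(maximalRealSubfield L) v : v.adicCompletion ↥(maximalRealSubfield L)) ^ n := by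
    rw [← map_pow]
    exact (v_eq_iff_valuation_eq _ _).1 (by rw [map_pow]; exact hzn)
  -- §2: the rescaled element `u′ ∈ U_w` and its data (`ε₀ := π₁`, `j ≤ n`)
  have hϖF1 : Valued.v (HeckeCharacter.uniformizer ↥(maximalRealSubfield L) v : v.adicCompletion ↥(maximalRealSubfield L)) < 1 := by
    rw [hϖF, ← WithZero.exp_zero, WithZero.exp_lt_exp]; norm_num
  have hεn : Valued.v π₁ * Valued.v (HeckeCharacter.uniformizer ↥(maximalRealSubfield L) v : v.adicCompletion ↥(maximalRealSubfield L)) ^ (2 * (n - j)) < 1 := by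
    rw [hπ₁, ← pow_succ']
    exact pow_lt_one₀ zero_le hϖF1 (by omega)
  obtain ⟨u', s', g', hs'0, hsg', htr', hz', hD', hzn', hs'v, htr2, haff, hk0, hkv⟩ :=
    exists_rescaled_descent_of_elliptic L v w hw he ϖ hϖ hσϖ hϖF h2v ((localNonsplitEquiv (IsCMField.complexConj L) (Matrix.of fun i j : Fin 2 => if i.val + j.val + 1 = 2 then (1 : L) else 0) (IsCMField.complexConj_ne_one L) w hw) γ₂) hs hsg rfl rfl ht hz hD hzn' hjn hεn
  set k : w.1.adicCompletion L := s' * toPlace v w (2 * ((HeckeCharacter.uniformizer ↥(maximalRealSubfield L) v : v.adicCompletion ↥(maximalRealSubfield L)) ^ j)⁻¹ *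
    ((g : Matrix (Fin 2) (Fin 2) (v.adicCompletion ↥(maximalRealSubfield L))).trace)⁻¹) * s⁻¹ with hk
  -- `c = ½ tr γ_{2,w} = s·ι(t∕2)`
  obtain ⟨htru, -⟩ := trace_and_det_of_descent (toPlace v w) hϖ0 hsg
  have hc : ((((localNonsplitEquiv (IsCMField.complexConj L) (Matrix.of fun i j : Fin 2 => if i.val + j.val + 1 = 2 then (1 : L) else 0) (IsCMField.complexConj_ne_one L) w hw) γ₂ : ↥(unitaryGroupOfForm (galAdicCompletionMap (L := L) (IsCMField.complexConj L) hw) (placeForm (Matrix.of fun i j : Fin 2 => if i.val + j.val + 1 = 2 then (1 : L) else 0) w.1))) : GL (Fin 2) (w.1.adicCompletion L)) : Matrix (Fin 2) (Fin 2) (w.1.adicCompletion L)).trace / 2 = s * toPlace v w ((g : Matrix (Fin 2) (Fin 2) (v.adicCompletion ↥(maximalRealSubfield L))).trace / 2) := by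
    rw [show ((((localNonsplitEquiv (IsCMField.complexConj L) (Matrix.of fun i j : Fin 2 => if i.val + j.val + 1 = 2 then (1 : L) else 0) (IsCMField.complexConj_ne_one L) w hw) γ₂ : ↥(unitaryGroupOfForm (galAdicCompletionMap (L := L) (IsCMField.complexConj L) hw) (placeForm (Matrix.of fun i j : Fin 2 => if i.val + j.val + 1 = 2 then (1 : L) else 0) w.1))) : GL (Fin 2) (w.1.adicCompletion L)) : Matrix (Fin 2) (Fin 2) (w.1.adicCompletion L)) = (((localNonsplitEquiv (IsCMField.complexConj L) (Matrix.of fun i j : Fin 2 => if i.val + j.val + 1 = 2 then (1 : L) else 0) (IsCMField.complexConj_ne_one L) w hw) γ₂ : GL (Fin 2) (w.1.adicCompletion L)) : Matrix (Fin 2) (Fin 2) (w.1.adicCompletion L)) from rfl, htru, map_div₀, map_ofNat]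
    ring
  -- the rescaled element on the `cmDatum` carrier
  set γ' : ((cmDatum L 2 (Matrix.of fun i j : Fin 2 => if i.val + j.val + 1 = 2 then (1 : L) else 0)).Local v) := (localNonsplitEquiv (IsCMField.complexConj L) (Matrix.of fun i j : Fin 2 => if i.val + j.val + 1 = 2 then (1 : L) else 0) (IsCMField.complexConj_ne_one L) w hw).symm u' with hγ'
  have hEγ' : (localNonsplitEquiv (IsCMField.complexConj L) (Matrix.of fun i j : Fin 2 => if i.val + j.val + 1 = 2 then (1 : L) else 0) (IsCMField.complexConj_ne_one L) w hw) γ' = u' := (localNonsplitEquiv (IsCMField.complexConj L) (Matrix.of fun i j : Fin 2 => if i.val + j.val + 1 = 2 then (1 : L) else 0) (IsCMField.complexConj_ne_one L) w hw).apply_symm_apply u'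
  have hcoe' : ((γ'.val : GL (Fin 2) (UnitaryGroup.LocalRing L v)).val.map (Pi.evalRingHom (fun w' : PlacesOver L v => w'.1.adicCompletion L) w)) =
      ((u' : GL (Fin 2) (w.1.adicCompletion L)) : Matrix (Fin 2) (Fin 2) (w.1.adicCompletion L)) := by
    rw [← hEγ']; rfl
  -- trace, determinant, discriminant of `u′` from its descent
  obtain ⟨htru', hdetu'⟩ := trace_and_det_of_descent (toPlace v w) hϖ0 hsg'
  rw [htr', map_ofNat] at htru'
  have hdisc' : ((u' : GL (Fin 2) (w.1.adicCompletion L)) : Matrix (Fin 2) (Fin 2) (w.1.adicCompletion L)).trace ^ 2 -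
      4 * ((u' : GL (Fin 2) (w.1.adicCompletion L)) : Matrix (Fin 2) (Fin 2) (w.1.adicCompletion L)).det ≠ 0 := by
    have hε00 : π₁ ≠ 0 := by
      intro h0
      rw [h0, map_zero] at hπ₁
      exact (Valuation.ne_zero_iff _).2 (HeckeCharacter.uniformizer ↥(maximalRealSubfield L) v).ne_zero hπ₁.symm
    have e : ((u' : GL (Fin 2) (w.1.adicCompletion L)) : Matrix (Fin 2) (Fin 2) (w.1.adicCompletion L)).trace ^ 2 -
        4 * ((u' : GL (Fin 2) (w.1.adicCompletion L)) : Matrix (Fin 2) (Fin 2) (w.1.adicCompletion L)).det =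
        s' ^ 2 * toPlace v w ((g' : Matrix (Fin 2) (Fin 2) (v.adicCompletion ↥(maximalRealSubfield L))).trace ^ 2 - 4 * (g' : Matrix (Fin 2) (Fin 2) (v.adicCompletion ↥(maximalRealSubfield L))).det) := by
      rw [htru', hdetu', map_sub, map_mul, map_pow, htr', map_ofNat, map_ofNat]; ring
    rw [e, hD']
    exact mul_ne_zero (pow_ne_zero _ hs'0) (by rw [_root_.map_ne_zero]; exact mul_ne_zero hε00 (pow_ne_zero _ hz'))
  -- `γ′` is regular with compact centraliser, no root at `w`, and deep trace
  have hirr' : ¬ ∃ x : (w.1.adicCompletion L), (((γ'.val : GL (Fin 2) (UnitaryGroup.LocalRing L v)).val.map (Pi.evalRingHom (fun w' : PlacesOver L v => w'.1.adicCompletion L) w)).charpoly).IsRoot x := by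
    rw [hcoe']
    rintro ⟨x, hx⟩
    exact hirr ⟨_, isRoot_charpoly_of_affine hk0 haff hx⟩
  have hreg' : IsRegularElt (γ'.val : GL (Fin 2) (UnitaryGroup.LocalRing L v)) := by
    rw [isRegularElt_iff_charpoly_localNonsplitEquiv L (Matrix.of fun i j : Fin 2 => if i.val + j.val + 1 = 2 then (1 : L) else 0) w hw γ', hEγ']
    exact charpoly_separable_of_disc_ne_zero _ hdisc'
  haveI := compactSpace_centralizer_cmDatum_two_of_not_exists_isRoot L v w hw (by rw [Matrix.det_fin_two]; simp) γ' hirr'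
  have htrd : Valued.v ((((γ'.val : GL (Fin 2) (UnitaryGroup.LocalRing L v)).val.map (Pi.evalRingHom (fun w' : PlacesOver L v => w'.1.adicCompletion L) w))).trace - 2) < 1 := by
    rw [hcoe', htru', mul_comm]; exact htr2
  -- the two ★ counts for `γ′` at depth `2·2(n−j)`
  have hsharp := sub_one_mul_natCard_fixedBy_add_two_eq_of_ramified_elliptic L v w hw he ϖ hϖ hσϖ hϖF C' hC' γ' hs'0 (by rw [hEγ']; exact hsg') h2v0 hπ₁' rfl rfl
    (by rw [htr']; exact two_ne_zero) hz' hD' (by rw [htr']; exact hzn')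
  have hK2 := isCompact_isOpen_cmLocalIntegralLevel L 2 (Matrix.of fun i j : Fin 2 => if i.val + j.val + 1 = 2 then (1 : L) else 0) v
  have hedge := natCard_fixedBy_add_one_eq_natCard_fixedBy_of_deep_of_ramified L v w hw he h2 ϖ hϖ (cmLocalIntegralLevel L 2 (Matrix.of fun i j : Fin 2 => if i.val + j.val + 1 = 2 then (1 : L) else 0) v) C'
    (fun g' => mem_localIntegralLevel_iff_of_smul_eq (IsCMField.complexConj L) 2 (Matrix.of fun i j : Fin 2 => if i.val + j.val + 1 = 2 then (1 : L) else 0) (IsCMField.complexConj_ne_one L) w hw g') hC' hK2.2 hK2.1 hC'o hC'c γ' hreg' htrd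
  -- arithmetic (as in ★ FILE C): `(q−1)·X♯ + 2 = (q+1)q^(n−j)`, `X⁰ + 1 = X♯`
  have hq2 : 2 ≤ Nat.card (𝓞 ↥(maximalRealSubfield L) ⧸ v.asIdeal) := by
    classical
    haveI : Finite (𝓞 ↥(maximalRealSubfield L) ⧸ v.asIdeal) := Ideal.finiteQuotientOfFreeOfNeBot v.asIdeal v.ne_bot
    haveI : Nontrivial (𝓞 ↥(maximalRealSubfield L) ⧸ v.asIdeal) := Ideal.Quotient.nontrivial_iff.2 v.isPrime.ne_top
    exact Finite.one_lt_card
  have hgeom : (∑ k ∈ Finset.range (n - j + 1), Nat.card (𝓞 ↥(maximalRealSubfield L) ⧸ v.asIdeal) ^ k) * (Nat.card (𝓞 ↥(maximalRealSubfield L) ⧸ v.asIdeal) - 1) + 1 =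
      Nat.card (𝓞 ↥(maximalRealSubfield L) ⧸ v.asIdeal) ^ (n - j + 1) := by
    have h := geom_sum_mul_add (Nat.card (𝓞 ↥(maximalRealSubfield L) ⧸ v.asIdeal) - 1) (n - j + 1)
    rwa [Nat.sub_add_cancel (by omega : 1 ≤ Nat.card (𝓞 ↥(maximalRealSubfield L) ⧸ v.asIdeal))] at h
  have hX : Nat.card (fixedBy (((cmDatum L 2 (Matrix.of fun i j : Fin 2 => if i.val + j.val + 1 = 2 then (1 : L) else 0)).Local v) ⧸ C') γ') = 2 * ∑ k ∈ Finset.range (n - j + 1), Nat.card (𝓞 ↥(maximalRealSubfield L) ⧸ v.asIdeal) ^ k := by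
    apply Nat.eq_of_mul_eq_mul_left (show 0 < Nat.card (𝓞 ↥(maximalRealSubfield L) ⧸ v.asIdeal) - 1 by omega)
    have key : (Nat.card (𝓞 ↥(maximalRealSubfield L) ⧸ v.asIdeal) - 1) * (2 * ∑ k ∈ Finset.range (n - j + 1), Nat.card (𝓞 ↥(maximalRealSubfield L) ⧸ v.asIdeal) ^ k) + 2 =
        2 * Nat.card (𝓞 ↥(maximalRealSubfield L) ⧸ v.asIdeal) ^ (n - j + 1) := by
      rw [← hgeom]; ring
    omega
  -- the IDENTIFICATION of the depth-refined sets with the fixed cosets of `γ′`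
  have hmem : ∀ (S : Subgroup ((cmDatum L 2 (Matrix.of fun i j : Fin 2 => if i.val + j.val + 1 = 2 then (1 : L) else 0)).Local v)) (y : ((cmDatum L 2 (Matrix.of fun i j : Fin 2 => if i.val + j.val + 1 = 2 then (1 : L) else 0)).Local v)), (y : ((cmDatum L 2 (Matrix.of fun i j : Fin 2 => if i.val + j.val + 1 = 2 then (1 : L) else 0)).Local v) ⧸ S) ∈ fixedBy (((cmDatum L 2 (Matrix.of fun i j : Fin 2 => if i.val + j.val + 1 = 2 then (1 : L) else 0)).Local v) ⧸ S) γ' ↔ y⁻¹ * γ' * y ∈ S := fun S y => by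
    rw [MulAction.mem_fixedBy, MulAction.Quotient.smul_coe, smul_eq_mul, QuotientGroup.eq, show (γ' * y)⁻¹ * y = (y⁻¹ * γ' * y)⁻¹ by group, inv_mem_iff]
  have hconj : ∀ (x y : ((cmDatum L 2 (Matrix.of fun i j : Fin 2 => if i.val + j.val + 1 = 2 then (1 : L) else 0)).Local v)), ((((localNonsplitEquiv (IsCMField.complexConj L) (Matrix.of fun i j : Fin 2 => if i.val + j.val + 1 = 2 then (1 : L) else 0) (IsCMField.complexConj_ne_one L) w hw) (y⁻¹ * x * y) : ↥(unitaryGroupOfForm (galAdicCompletionMap (L := L) (IsCMField.complexConj L) hw) (placeForm (Matrix.of fun i j : Fin 2 => if i.val + j.val + 1 = 2 then (1 : L) else 0) w.1))) : GL (Fin 2) (w.1.adicCompletion L)) : Matrix (Fin 2) (Fin 2) (w.1.adicCompletion L)) =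
      ((((((localNonsplitEquiv (IsCMField.complexConj L) (Matrix.of fun i j : Fin 2 => if i.val + j.val + 1 = 2 then (1 : L) else 0) (IsCMField.complexConj_ne_one L) w hw) y : ↥(unitaryGroupOfForm (galAdicCompletionMap (L := L) (IsCMField.complexConj L) hw) (placeForm (Matrix.of fun i j : Fin 2 => if i.val + j.val + 1 = 2 then (1 : L) else 0) w.1))) : GL (Fin 2) (w.1.adicCompletion L)))⁻¹ : GL (Fin 2) (w.1.adicCompletion L)) : Matrix (Fin 2) (Fin 2) (w.1.adicCompletion L)) * ((((localNonsplitEquiv (IsCMField.complexConj L) (Matrix.of fun i j : Fin 2 => if i.val + j.val + 1 = 2 then (1 : L) else 0) (IsCMField.complexConj_ne_one L) w hw) x : ↥(unitaryGroupOfForm (galAdicCompletionMap (L := L) (IsCMField.complexConj L) hw) (placeForm (Matrix.of fun i j : Fin 2 => if i.val + j.val + 1 = 2 then (1 : L) else 0) w.1))) : GL (Fin 2) (w.1.adicCompletion L)) : Matrix (Fin 2) (Fin 2) (w.1.adicCompletion L)) * ((((localNonsplitEquiv (IsCMField.complexConj L) (Matrix.of fun i j : Fin 2 => if i.val + j.val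 + 1 = 2 then (1 : L) else 0) (IsCMField.complexConj_ne_one L) w hw) y : ↥(unitaryGroupOfForm (galAdicCompletionMap (L := L) (IsCMField.complexConj L) hw) (placeForm (Matrix.of fun i j : Fin 2 => if i.val + j.val + 1 = 2 then (1 : L) else 0) w.1))) : GL (Fin 2) (w.1.adicCompletion L)) : Matrix (Fin 2) (Fin 2) (w.1.adicCompletion L)) := by
    intro x y
    have h1 := map_mul (localNonsplitEquiv (IsCMField.complexConj L) (Matrix.of fun i j : Fin 2 => if i.val + j.val + 1 = 2 then (1 : L) else 0) (IsCMField.complexConj_ne_one L) w hw) (y⁻¹ * x) y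
    have h2 := map_mul (localNonsplitEquiv (IsCMField.complexConj L) (Matrix.of fun i j : Fin 2 => if i.val + j.val + 1 = 2 then (1 : L) else 0) (IsCMField.complexConj_ne_one L) w hw) y⁻¹ x
    have h3 := map_inv (localNonsplitEquiv (IsCMField.complexConj L) (Matrix.of fun i j : Fin 2 => if i.val + j.val + 1 = 2 then (1 : L) else 0) (IsCMField.complexConj_ne_one L) w hw) y
    rw [h2, h3] at h1
    have h4 := congrArg (fun z : ↥(unitaryGroupOfForm (galAdicCompletionMap (L := L) (IsCMField.complexConj L) hw) (placeForm (Matrix.of fun i j : Fin 2 => if i.val + j.val + 1 = 2 then (1 : L) else 0) w.1)) => ((z : GL (Fin 2) (w.1.adicCompletion L)) : Matrix (Fin 2) (Fin 2) (w.1.adicCompletion L))) h1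
    simp only [Subgroup.coe_mul, Subgroup.coe_inv, Units.val_mul] at h4
    exact h4
  have hdet1 : ∀ y : ((cmDatum L 2 (Matrix.of fun i j : Fin 2 => if i.val + j.val + 1 = 2 then (1 : L) else 0)).Local v), Valued.v ((((localNonsplitEquiv (IsCMField.complexConj L) (Matrix.of fun i j : Fin 2 => if i.val + j.val + 1 = 2 then (1 : L) else 0) (IsCMField.complexConj_ne_one L) w hw) y : ↥(unitaryGroupOfForm (galAdicCompletionMap (L := L) (IsCMField.complexConj L) hw) (placeForm (Matrix.of fun i j : Fin 2 => if i.val + j.val + 1 = 2 then (1 : L) else 0) w.1))) : GL (Fin 2) (w.1.adicCompletion L)) : Matrix (Fin 2) (Fin 2) (w.1.adicCompletion L)).det = 1 := fun y => v_det_coe_eq_one_of_mem_placeForm L w hw ((localNonsplitEquiv (IsCMField.complexConj L) (Matrix.of fun i j : Fin 2 => if i.val + j.val + 1 = 2 then (1 : L) else 0) (IsCMField.complexConj_ne_one L) w hw) y)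
  -- the monodromy of `γ′` at `h` is the affine image of the monodromy of `γ₂`
  have hmono : ∀ h : ((cmDatum L 2 (Matrix.of fun i j : Fin 2 => if i.val + j.val + 1 = 2 then (1 : L) else 0)).Local v), ((((localNonsplitEquiv (IsCMField.complexConj L) (Matrix.of fun i j : Fin 2 => if i.val + j.val + 1 = 2 then (1 : L) else 0) (IsCMField.complexConj_ne_one L) w hw) (h⁻¹ * γ' * h) : ↥(unitaryGroupOfForm (galAdicCompletionMap (L := L) (IsCMField.complexConj L) hw) (placeForm (Matrix.of fun i j : Fin 2 => if i.val + j.val + 1 = 2 then (1 : L) else 0) w.1))) : GL (Fin 2) (w.1.adicCompletion L)) : Matrix (Fin 2) (Fin 2) (w.1.adicCompletion L)) = s' • (1 : Matrix (Fin 2) (Fin 2) (w.1.adicCompletion L)) + k • (((((localNonsplitEquiv (IsCMField.complexConj L) (Matrix.of fun i j : Fin 2 => if i.val + j.val + 1 = 2 then (1 : L) else 0) (IsCMField.complexConj_ne_one L) w hw) (h⁻¹ * γ₂ * h) : ↥(unitaryGroupOfForm (galAdicCompletionMap (L := L) (IsCMField.complexConj L) hw) (placeForm (Matrix.of fun i j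 : Fin 2 => if i.val + j.val + 1 = 2 then (1 : L) else 0) w.1))) : GL (Fin 2) (w.1.adicCompletion L)) : Matrix (Fin 2) (Fin 2) (w.1.adicCompletion L)) - (((((localNonsplitEquiv (IsCMField.complexConj L) (Matrix.of fun i j : Fin 2 => if i.val + j.val + 1 = 2 then (1 : L) else 0) (IsCMField.complexConj_ne_one L) w hw) γ₂ : ↥(unitaryGroupOfForm (galAdicCompletionMap (L := L) (IsCMField.complexConj L) hw) (placeForm (Matrix.of fun i j : Fin 2 => if i.val + j.val + 1 = 2 then (1 : L) else 0) w.1))) : GL (Fin 2) (w.1.adicCompletion L)) : Matrix (Fin 2) (Fin 2) (w.1.adicCompletion L)).trace / 2) • (1 : Matrix (Fin 2) (Fin 2) (w.1.adicCompletion L))) := by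
    intro h
    rw [hconj γ' h, hconj γ₂ h, hc, show (((localNonsplitEquiv (IsCMField.complexConj L) (Matrix.of fun i j : Fin 2 => if i.val + j.val + 1 = 2 then (1 : L) else 0) (IsCMField.complexConj_ne_one L) w hw) γ' : ↥(unitaryGroupOfForm (galAdicCompletionMap (L := L) (IsCMField.complexConj L) hw) (placeForm (Matrix.of fun i j : Fin 2 => if i.val + j.val + 1 = 2 then (1 : L) else 0) w.1))) : GL (Fin 2) (w.1.adicCompletion L)) = (u' : GL (Fin 2) (w.1.adicCompletion L)) by rw [hEγ'], haff, conj_affine]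
  have hϖ2j : Valued.v ((ϖ : (w.1.adicCompletion L)) ^ (2 * j)) = (Valued.v k)⁻¹ := by rw [Valuation.map_pow, hkv]
  -- the `K⁰` column
  have hK0mem : ∀ y : ((cmDatum L 2 (Matrix.of fun i j : Fin 2 => if i.val + j.val + 1 = 2 then (1 : L) else 0)).Local v), y ∈ (cmLocalIntegralLevel L 2 (Matrix.of fun i j : Fin 2 => if i.val + j.val + 1 = 2 then (1 : L) else 0) v) ↔ ∀ a b : Fin 2, Valued.v (((((localNonsplitEquiv (IsCMField.complexConj L) (Matrix.of fun i j : Fin 2 => if i.val + j.val + 1 = 2 then (1 : L) else 0) (IsCMField.complexConj_ne_one L) w hw) y : ↥(unitaryGroupOfForm (galAdicCompletionMap (L := L) (IsCMField.complexConj L) hw) (placeForm (Matrix.of fun i j : Fin 2 => if i.val + j.val + 1 = 2 then (1 : L) else 0) w.1))) : GL (Fin 2) (w.1.adicCompletion L)) : Matrix (Fin 2) (Fin 2) (w.1.adicCompletion L)) a b) ≤ 1 := fun y => by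
    refine (mem_localIntegralLevel_iff_of_smul_eq (IsCMField.complexConj L) 2 (Matrix.of fun i j : Fin 2 => if i.val + j.val + 1 = 2 then (1 : L) else 0) (IsCMField.complexConj_ne_one L) w hw y).trans ?_
    rw [mem_glInt_iff_forall_v_le_one_and_v_det_eq_one]
    exact ⟨fun h => h.1, fun h => ⟨h, hdet1 y⟩⟩
  have hS0 : {x : ((cmDatum L 2 (Matrix.of fun i j : Fin 2 => if i.val + j.val + 1 = 2 then (1 : L) else 0)).Local v) ⧸ (cmLocalIntegralLevel L 2 (Matrix.of fun i j : Fin 2 => if i.val + j.val + 1 = 2 then (1 : L) else 0) v) | ∃ h : ((cmDatum L 2 (Matrix.of fun i j : Fin 2 => if i.val + j.val + 1 = 2 then (1 : L) else 0)).Local v), x = (h : ((cmDatum L 2 (Matrix.of fun i j : Fin 2 => if i.val + j.val + 1 = 2 then (1 : L) else 0)).Local v) ⧸ (cmLocalIntegralLevel L 2 (Matrix.of fun i j : Fin 2 => if i.val + j.val + 1 = 2 then (1 : L) else 0) v)) ∧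
      ∀ a b : Fin 2, Valued.v ((((((localNonsplitEquiv (IsCMField.complexConj L) (Matrix.of fun i j : Fin 2 => if i.val + j.val + 1 = 2 then (1 : L) else 0) (IsCMField.complexConj_ne_one L) w hw) (h⁻¹ * γ₂ * h) : ↥(unitaryGroupOfForm (galAdicCompletionMap (L := L) (IsCMField.complexConj L) hw) (placeForm (Matrix.of fun i j : Fin 2 => if i.val + j.val + 1 = 2 then (1 : L) else 0) w.1))) : GL (Fin 2) (w.1.adicCompletion L)) : Matrix (Fin 2) (Fin 2) (w.1.adicCompletion L)) - (((((localNonsplitEquiv (IsCMField.complexConj L) (Matrix.of fun i j : Fin 2 => if i.val + j.val + 1 = 2 then (1 : L) else 0) (IsCMField.complexConj_ne_one L) w hw) γ₂ : ↥(unitaryGroupOfForm (galAdicCompletionMap (L := L) (IsCMField.complexConj L) hw) (placeForm (Matrix.of fun i j : Fin 2 => if i.val + j.val + 1 = 2 then (1 : L) else 0) w.1))) : GL (Fin 2) (w.1.adicCompletion L)) : Matrix (Fin 2) (Fin 2) (w.1.adicCompletion L)).trace / 2) • (1 : Matrix (Fin 2) (Fin 2) (w.1.adicCompletion L))) a b)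 ≤ Valued.v ((ϖ : (w.1.adicCompletion L)) ^ (2 * j))} = fixedBy (((cmDatum L 2 (Matrix.of fun i j : Fin 2 => if i.val + j.val + 1 = 2 then (1 : L) else 0)).Local v) ⧸ (cmLocalIntegralLevel L 2 (Matrix.of fun i j : Fin 2 => if i.val + j.val + 1 = 2 then (1 : L) else 0) v)) γ' := by
    ext x
    obtain ⟨h, rfl⟩ := QuotientGroup.mk_surjective x
    rw [hmem, hK0mem, hmono h, forall_v_le_one_affine_iff hs'v hk0, ← hϖ2j, Set.mem_setOf_eq]
    constructor
    · rintro ⟨h', hh', hP⟩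
      have hhh : (h' : ((cmDatum L 2 (Matrix.of fun i j : Fin 2 => if i.val + j.val + 1 = 2 then (1 : L) else 0)).Local v) ⧸ (cmLocalIntegralLevel L 2 (Matrix.of fun i j : Fin 2 => if i.val + j.val + 1 = 2 then (1 : L) else 0) v)) ∈ fixedBy (((cmDatum L 2 (Matrix.of fun i j : Fin 2 => if i.val + j.val + 1 = 2 then (1 : L) else 0)).Local v) ⧸ (cmLocalIntegralLevel L 2 (Matrix.of fun i j : Fin 2 => if i.val + j.val + 1 = 2 then (1 : L) else 0) v)) γ' ↔ (h : ((cmDatum L 2 (Matrix.of fun i j : Fin 2 => if i.val + j.val + 1 = 2 then (1 : L) else 0)).Local v) ⧸ (cmLocalIntegralLevel L 2 (Matrix.of fun i j : Fin 2 => if i.val + j.val + 1 = 2 then (1 : L) else 0) v)) ∈ fixedBy (((cmDatum L 2 (Matrix.of fun i j : Fin 2 => if i.val + j.val + 1 = 2 then (1 : L) else 0)).Local v) ⧸ (cmLocalIntegralLevel L 2 (Matrix.of fun i j : Fin 2 => if i.val + j.val + 1 = 2 then (1 : L) else 0) v)) γ' := by rw [hh']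
      rw [hmem, hmem, hK0mem, hK0mem, hmono h, hmono h', forall_v_le_one_affine_iff hs'v hk0, forall_v_le_one_affine_iff hs'v hk0, ← hϖ2j] at hhh
      exact hhh.1 hP
    · intro hP
      exact ⟨h, rfl, hP⟩
  -- the `C′` column: `E₂(y) ∈ D_ϖ GL₂(𝒪_w) D_ϖ⁻¹ ⟺ |ϖ^b ϖ^(−a) E₂(y)_{ab}| ≤ 1`
  have hCmem : ∀ y : ((cmDatum L 2 (Matrix.of fun i j : Fin 2 => if i.val + j.val + 1 = 2 then (1 : L) else 0)).Local v), y ∈ C' ↔ ∀ a b : Fin 2, Valued.v ((ϖ : (w.1.adicCompletion L)) ^ (b : ℕ) * ((ϖ : (w.1.adicCompletion L)) ^ (a : ℕ))⁻¹ * ((((localNonsplitEquiv (IsCMField.complexConj L) (Matrix.of fun i j : Fin 2 => if i.val + j.val + 1 = 2 then (1 : L) else 0) (IsCMField.complexConj_ne_one L) w hw) y : ↥(unitaryGroupOfForm (galAdicCompletionMap (L := L) (IsCMField.complexConj L) hw) (placeForm (Matrix.of fun i j : Fin 2 => if i.val + j.val + 1 = 2 then (1 : L) else 0) w.1))) : GL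 (Fin 2) (w.1.adicCompletion L)) : Matrix (Fin 2) (Fin 2) (w.1.adicCompletion L)) a b) ≤ 1 :=
    fun y => by rw [hC' y, forall_v_sharp_iff_coe_mem_map_conj L w hw ϖ]
  have htwist : ∀ (h : ((cmDatum L 2 (Matrix.of fun i j : Fin 2 => if i.val + j.val + 1 = 2 then (1 : L) else 0)).Local v)) (a b : Fin 2), (ϖ : (w.1.adicCompletion L)) ^ (b : ℕ) * ((ϖ : (w.1.adicCompletion L)) ^ (a : ℕ))⁻¹ * ((((localNonsplitEquiv (IsCMField.complexConj L) (Matrix.of fun i j : Fin 2 => if i.val + j.val + 1 = 2 then (1 : L) else 0) (IsCMField.complexConj_ne_one L) w hw) (h⁻¹ * γ' * h) : ↥(unitaryGroupOfForm (galAdicCompletionMap (L := L) (IsCMField.complexConj L) hw) (placeForm (Matrix.of fun i j : Fin 2 => if i.val + j.val + 1 = 2 then (1 : L) else 0) w.1))) : GL (Fin 2) (w.1.adicCompletion L)) : Matrix (Fin 2) (Fin 2) (w.1.adicCompletion L)) a b =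
      (s' • (1 : Matrix (Fin 2) (Fin 2) (w.1.adicCompletion L)) + k • (Matrix.of fun a b : Fin 2 => (ϖ : (w.1.adicCompletion L)) ^ (b : ℕ) * ((ϖ : (w.1.adicCompletion L)) ^ (a : ℕ))⁻¹ * (((((localNonsplitEquiv (IsCMField.complexConj L) (Matrix.of fun i j : Fin 2 => if i.val + j.val + 1 = 2 then (1 : L) else 0) (IsCMField.complexConj_ne_one L) w hw) (h⁻¹ * γ₂ * h) : ↥(unitaryGroupOfForm (galAdicCompletionMap (L := L) (IsCMField.complexConj L) hw) (placeForm (Matrix.of fun i j : Fin 2 => if i.val + j.val + 1 = 2 then (1 : L) else 0) w.1))) : GL (Fin 2) (w.1.adicCompletion L)) : Matrix (Fin 2) (Fin 2) (w.1.adicCompletion L)) - (((((localNonsplitEquiv (IsCMField.complexConj L) (Matrix.of fun i j : Fin 2 => if i.val + j.val + 1 = 2 then (1 : L) else 0) (IsCMField.complexConj_ne_one L) w hw) γ₂ : ↥(unitaryGroupOfForm (galAdicCompletionMap (L := L) (IsCMField.complexConj L) hw) (placeForm (Matrix.of fun i j : Fin 2 => if i.val + j.val + 1 = 2 then (1 :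 L) else 0) w.1))) : GL (Fin 2) (w.1.adicCompletion L)) : Matrix (Fin 2) (Fin 2) (w.1.adicCompletion L)).trace / 2) • (1 : Matrix (Fin 2) (Fin 2) (w.1.adicCompletion L))) a b)) a b := by
    intro h a b
    rw [hmono h]
    simp only [Matrix.add_apply, Matrix.smul_apply, Matrix.of_apply, smul_eq_mul]
    by_cases hab : a = b
    · rw [hab, Matrix.one_apply_eq, mul_inv_cancel₀ (pow_ne_zero _ hϖ0)]; ring
    · rw [Matrix.one_apply_ne hab]; ring
  have hCmem' : ∀ h : ((cmDatum L 2 (Matrix.of fun i j : Fin 2 => if i.val + j.val + 1 = 2 then (1 : L) else 0)).Local v), h⁻¹ * γ' * h ∈ C' ↔ ∀ a b : Fin 2, Valued.v ((ϖ : (w.1.adicCompletion L)) ^ (b : ℕ) * ((ϖ : (w.1.adicCompletion L)) ^ (a : ℕ))⁻¹ * (((((localNonsplitEquiv (IsCMField.complexConj L) (Matrix.of fun i j : Fin 2 => if i.val + j.val + 1 = 2 then (1 : L) else 0) (IsCMField.complexConj_ne_one L) w hw) (h⁻¹ * γ₂ * h) : ↥(unitaryGroupOfForm (galAdicCompletionMap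 (L := L) (IsCMField.complexConj L) hw) (placeForm (Matrix.of fun i j : Fin 2 => if i.val + j.val + 1 = 2 then (1 : L) else 0) w.1))) : GL (Fin 2) (w.1.adicCompletion L)) : Matrix (Fin 2) (Fin 2) (w.1.adicCompletion L)) - (((((localNonsplitEquiv (IsCMField.complexConj L) (Matrix.of fun i j : Fin 2 => if i.val + j.val + 1 = 2 then (1 : L) else 0) (IsCMField.complexConj_ne_one L) w hw) γ₂ : ↥(unitaryGroupOfForm (galAdicCompletionMap (L := L) (IsCMField.complexConj L) hw) (placeForm (Matrix.of fun i j : Fin 2 => if i.val + j.val + 1 = 2 then (1 : L) else 0) w.1))) : GL (Fin 2) (w.1.adicCompletion L)) : Matrix (Fin 2) (Fin 2) (w.1.adicCompletion L)).trace / 2) • (1 : Matrix (Fin 2) (Fin 2) (w.1.adicCompletion L))) a b) ≤ Valued.v ((ϖ : (w.1.adicCompletion L)) ^ (2 * j)) := by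
    intro h
    rw [hCmem]
    simp_rw [htwist h]
    rw [forall_v_le_one_affine_iff hs'v hk0, ← hϖ2j]
    simp only [Matrix.of_apply]
  have hS1 : {x : ((cmDatum L 2 (Matrix.of fun i j : Fin 2 => if i.val + j.val + 1 = 2 then (1 : L) else 0)).Local v) ⧸ C' | ∃ h : ((cmDatum L 2 (Matrix.of fun i j : Fin 2 => if i.val + j.val + 1 = 2 then (1 : L) else 0)).Local v), x = (h : ((cmDatum L 2 (Matrix.of fun i j : Fin 2 => if i.val + j.val + 1 = 2 then (1 : L) else 0)).Local v) ⧸ C') ∧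
      ∀ a b : Fin 2, Valued.v ((ϖ : (w.1.adicCompletion L)) ^ (b : ℕ) * ((ϖ : (w.1.adicCompletion L)) ^ (a : ℕ))⁻¹ * (((((localNonsplitEquiv (IsCMField.complexConj L) (Matrix.of fun i j : Fin 2 => if i.val + j.val + 1 = 2 then (1 : L) else 0) (IsCMField.complexConj_ne_one L) w hw) (h⁻¹ * γ₂ * h) : ↥(unitaryGroupOfForm (galAdicCompletionMap (L := L) (IsCMField.complexConj L) hw) (placeForm (Matrix.of fun i j : Fin 2 => if i.val + j.val + 1 = 2 then (1 : L) else 0) w.1))) : GL (Fin 2) (w.1.adicCompletion L)) : Matrix (Fin 2) (Fin 2) (w.1.adicCompletion L)) - (((((localNonsplitEquiv (IsCMField.complexConj L) (Matrix.of fun i j : Fin 2 => if i.val + j.val + 1 = 2 then (1 : L) else 0) (IsCMField.complexConj_ne_one L) w hw) γ₂ : ↥(unitaryGroupOfForm (galAdicCompletionMap (L := L) (IsCMField.complexConj L) hw) (placeForm (Matrix.of fun i j : Fin 2 => if i.val + j.val + 1 = 2 then (1 : L) else 0) w.1))) : GL (Fin 2) (w.1.adicCompletion L)) : Matrix (Fin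 2) (Fin 2) (w.1.adicCompletion L)).trace / 2) • (1 : Matrix (Fin 2) (Fin 2) (w.1.adicCompletion L))) a b) ≤ Valued.v ((ϖ : (w.1.adicCompletion L)) ^ (2 * j))} = fixedBy (((cmDatum L 2 (Matrix.of fun i j : Fin 2 => if i.val + j.val + 1 = 2 then (1 : L) else 0)).Local v) ⧸ C') γ' := by
    ext x
    obtain ⟨h, rfl⟩ := QuotientGroup.mk_surjective x
    rw [hmem, hCmem', Set.mem_setOf_eq]
    constructor
    · rintro ⟨h', hh', hP⟩
      have hhh : (h' : ((cmDatum L 2 (Matrix.of fun i j : Fin 2 => if i.val + j.val + 1 = 2 then (1 : L) else 0)).Local v) ⧸ C') ∈ fixedBy (((cmDatum L 2 (Matrix.of fun i j : Fin 2 => if i.val + j.val + 1 = 2 then (1 : L) else 0)).Local v) ⧸ C') γ' ↔ (h : ((cmDatum L 2 (Matrix.of fun i j : Fin 2 => if i.val + j.val + 1 = 2 then (1 : L) else 0)).Local v) ⧸ C') ∈ fixedBy (((cmDatum L 2 (Matrix.of fun i j : Fin 2 => if i.val + j.val + 1 = 2 then (1 : L) else 0)).Local v) ⧸ C') γ' :=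 by rw [hh']
      rw [hmem, hmem, hCmem', hCmem'] at hhh
      exact hhh.1 hP
    · intro hP
      exact ⟨h, rfl, hP⟩
  refine ⟨?_, ?_⟩
  · rw [hS0]; omega
  · rw [hS1]; exact hX

end CountsOdd


end Literature.NumberTheory.Automorphic.UnitaryGroup

end
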